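import Summits.Ventures.CertifiedManyBodySolver.Observables.PairLROGroundStateClassChargedCells
import Summits.Ventures.CertifiedManyBodySolver.Observables.PairLROTowerChargedCells
import Summits.Ventures.CertifiedManyBodySolver.Observables.PairLROTowerWitnessGroundStateAllMu
import Summits.Ventures.CertifiedManyBodySolver.Observables.PairLROTowerWitnessGroundStateHalfFilling
import HarnessLib

/-!
# OP1-C in IDENTITY FORM, part 2: the PAIR-AMPLITUDE cell node on the ground-state class and the `μ`-COVER
# consumer to the registry leaf `ObsPairLROCeilingAt` through the ground-state-complete one-point reading

HONEST FRAMING: soundness / bookkeeping theorems for a CEILING route at positivity scale; a ceiling never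
speaks to the presence of pairing; not a superconductivity verdict; nothing in this file is a number. Crew
hubbard-obs (D-0042), seat hubbard-obs-p1 (`prover-hubbard-obs-p1-g11-0`), PAIRCORR-SDP §18.11 (a) / §19. Zero
compute; no definition; no named fact; no `sorry`.

* §3 `two_mul_re_expect_localPairAt_le_of_chargedCell_certificate` — the identity of part 1 with the pair objective
  `Xw = −(Γ P₀^d + (Γ P₀^d)ᴴ)`: `2 Re ω(P₀^d) ≤ −(c − Σ‖aₖ‖ + (Σμ)(ρ(ω)/2 − ν)) + Δ·Σᵢ|ccᵢqᵢ|Bauxᵢ` for every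
  translation-invariant minimiser `ω` of `H^{tt'} − μ_c N`, `|μ' − μ_c| ≤ Δ` (the CELL SENTENCE of a `μ'`-cell).
* §4 `ObsPairLROCeilingAt_of_groundStateClass_cells` — cells covering a certified bracket `⊇ [μ₋(n), μ₊(n)]` + the cap
  `e(n) ≤ u` ⇒ `ObsPairLROCeilingAt t' U n c'` (`c' ≥ max_j M_j²`), by hubbard-obs-gs-2's ground-state-complete reading
  `ObsPairLROCeilingAt_of_groundState_onePoint_bound` (the tower witnesses' torus limits ARE such minimisers at every
  `μ` of the subdifferential, so ONE cell of the cover applies; sharp Koma–Tasaki constant).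
* §5 (appended) `ObsPairLROCeilingAt_of_groundStateClass_gridCells` — PRODUCER FORM: a monotone `μ`-grid of closed
  cells with grid points and half-widths (finitely many rational inequalities), one cell sentence per cell.
* §6 (appended) `ObsPairLROCeilingAt_of_groundStateClass_cell_at` — ONE cell at a CERTIFIED point `μ₀ ∈ [μ₋(n), μ₊(n)]`
  (gs-2's «all `μ`» reading `…_onePoint_bound_at`); `ObsPairLROCeilingAt_halfFilling_of_groundStateClass_cell` — at
  `(U, 1, 0)` particle–hole gives `μ₀ = U/2`: one cell around `U/2`, the degenerate cell `Δ = 0` = charged rows EXACT.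

References: T. Koma, H. Tasaki, J. Stat. Phys. 76 (1994) 745, §1 and Theorem 5 [KomaTasaki1994]; O. Bratteli,
A. Kishimoto, D. W. Robinson, Commun. Math. Phys. 64 (1978) 41, Thm. 2 [BratteliKishimotoRobinson1978]; J. Wang et al.,
PRX 14 (2024) 031006, §III [WangEtAl2024]; M. Araújo et al., arXiv:2311.18707, §3.2 Prop. 11 [AraujoEtAl2023];
D. Ruelle, *Statistical Mechanics* (1969) §3.4 [Ruelle1969].
-/

noncomputable section

namespace Summit.Ventures.CertifiedManyBodySolver.Observables

open Matrix Complex Finset Literature.MathematicalPhysics.QuantumLattice Literature.Probability.LatticeModels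
open Literature.MathematicalPhysics.QuantumLattice.HubbardWave0 ThermodynamicLimit Filter Topology
open Literature.MathematicalPhysics.QuantumManyBody.StateRelaxation
open Literature.MathematicalPhysics.QuantumLattice.InfVolFermionState (TwistFlipIndex twistedFlipAct
  twistedFlipAct_density)
open scoped ComplexOrder ComplexConjugate BigOperators

section CellsB

variable {ω : InfVolFermionState 2} {t' U : ℝ}

/-! ### §3  The node shapes on the class: PAIR-AMPLITUDE MAX in a `μ'`-cell; auxiliary two-sided bounds -/

/-- **PAIR-AMPLITUDE MAX in a `μ'`-cell, on the ground-state class** (`Xw = −(Γ P₀^d + (Γ P₀^d)ᴴ)`): the identity of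
`re_sum_twistedFlipAct_expect_ge_of_chargedCell_certificate` with this objective proves, for every translation-invariant
minimiser `ω` of `H^{tt'} − μ_c N` with `|μ' − μ_c| ≤ Δ`,
`2 Re ω(P₀^d) ≤ −(c − Σ‖aₖ‖ + (Σ_σ μ_σ)(ρ(ω)/2 − ν)) + Δ · Σᵢ |ccᵢ qᵢ| Bauxᵢ`.
[cite: KomaTasaki1994, §1] [cite: WangEtAl2024, §III] [cite: AraujoEtAl2023, §3.2 Prop. 11] -/
theorem two_mul_re_expect_localPairAt_le_of_chargedCell_certificate {μc μ' Δ : ℝ}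
    (hmin : ω.IsMeanEnergyMinimiser (hubbardTTPrimeSourcedInteraction 1 t' U μc dWaveFormFactor 0) 1)
    (hnear : |μ' - μc| ≤ Δ)
    {Λ Λ' : Finset (Site 2)} (hΛ : Λ ⊆ Λ') (h8 : thicken Λ 1 ⊆ Λ') (h0 : thicken ({0} : Finset (Site 2)) 1 ⊆ Λ')
    (hz : (0 : Site 2) ∈ Λ') (hP : pairRegion (insert (0 : Site 2) unitSteps) 0 ⊆ Λ')
    (κp κm u lo : ℝ) (μf : Fin 2 → ℝ) (ν : ℝ)
    (hcap : κp * ω.meanEnergy (hubbardTTPrimeFermionInteraction 1 t' U) 1 ≤ κp * u)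
    (hlo : ∀ σ : InfVolFermionState 2, σ.IsTranslationInvariant → σ.density = ω.density →
      κm * lo ≤ κm * σ.meanEnergy (hubbardTTPrimeFermionInteraction 1 t' U) 1)
    {m : Type*} [Fintype m] [DecidableEq m] {Λm : Matrix m m ℂ} (hΛm : Λm.PosSemidef) (O : m → FermionOp Λ')
    {κ' : Type*} (s : Finset κ') (B : κ' → FermionOp Λ)
    (hB0 : ∀ k ∈ s, (totalNumber : FermionOp Λ) * B k - B k * totalNumber = 0)
    {κc : Type*} (sc : Finset κc) (cc Baux : κc → ℝ) (lc : κc → List (Orb (PolySite Λ) × Bool))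
    (haux : ∀ i ∈ sc, |(∑ g : TwistFlipIndex,
        ((ω.twistedFlipAct g).expect Λ' (fermionEmbed (PolySite.incl hΛ) (ladderWord (lc i)))).re) / 32| ≤ Baux i)
    {ι : Type*} (tt : Finset ι) (γ : ι → DihedralGroup 4) (wv : ι → Site 2) (fl mt : ι → Fin 2)
    (hsh : ∀ l, d4ShiftSet (γ l) (wv l) Λ ⊆ Λ') (bb : ι → ℂ) (yw : ι → List (Orb (PolySite Λ) × Bool))
    {δ : Type*} (ah : Finset δ) (dc : δ → ℝ) (V : δ → FermionOp Λ')
    {κ'' : Type*} (w : Finset κ'') (a : κ'' → ℂ) (word : κ'' → List (Orb (PolySite Λ') × Bool))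
    {ε : Type*} (kk : Finset ε) {β : Type*} [Fintype β] [DecidableEq β]
    (G : ε → Matrix β β ℂ) (hG : ∀ e ∈ kk, (G e).PosSemidef) (Bk : ε → β → FermionOp Λ) (qk sk : ε → ℝ)
    (hqk : ∀ e ∈ kk, ∀ b, (totalNumber : FermionOp Λ) * Bk e b - Bk e b * totalNumber = ((qk e : ℝ) : ℂ) • Bk e b)
    (hsk : ∀ e ∈ kk, Δ * |qk e| ≤ sk e) {c : ℝ}
    (hcert : -(fermionEmbed (PolySite.incl hP) (localPairAt (insert (0 : Site 2) unitSteps) dWaveFormFactor 0) +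
          (fermionEmbed (PolySite.incl hP) (localPairAt (insert (0 : Site 2) unitSteps) dWaveFormFactor 0))ᴴ) -
        (c : ℂ) • (1 : FermionOp Λ') -
        ∑ σ : Fin 2, ((μf σ : ℝ) : ℂ) • (nAt 0 hz σ - ((ν : ℝ) : ℂ) • (1 : FermionOp Λ')) -
        ((κp : ℝ) : ℂ) • (((u : ℝ) : ℂ) • (1 : FermionOp Λ') -
          fermionEmbed (PolySite.incl h0) ((hubbardTTPrimeFermionInteraction 1 t' U).meanEnergyObs 1)) -
        ((κm : ℝ) : ℂ) • (fermionEmbed (PolySite.incl h0) ((hubbardTTPrimeFermionInteraction 1 t' U).meanEnergyObs 1) -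
          ((lo : ℝ) : ℂ) • (1 : FermionOp Λ')) =
      gramForm Λm O +
        (∑ k ∈ s, (pairSourceWindowHamiltonianTT' dWaveFormFactor Λ' t' U μ' 0 * fermionEmbed (PolySite.incl hΛ) (B k) -
            fermionEmbed (PolySite.incl hΛ) (B k) * pairSourceWindowHamiltonianTT' dWaveFormFactor Λ' t' U μ' 0) +
          ∑ i ∈ sc, ((cc i : ℝ) : ℂ) •
            (pairSourceWindowHamiltonianTT' dWaveFormFactor Λ' t' U μ' 0 *
                fermionEmbed (PolySite.incl hΛ) (ladderWord (lc i)) -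
              fermionEmbed (PolySite.incl hΛ) (ladderWord (lc i)) *
                pairSourceWindowHamiltonianTT' dWaveFormFactor Λ' t' U μ' 0) +
          ∑ l ∈ tt, bb l • (gaugePhase (twistFlipExp (γ l) (fl l) (mt l)) (yw l) •
              fermionEmbed (PolySite.incl (hsh l))
                (fermionEmbed (PolySite.d4Emb (γ l) (wv l) Λ) (spinSwapIter (fl l).val (ladderWord (yw l)))) -
            fermionEmbed (PolySite.incl hΛ) (ladderWord (yw l)))) +
        (∑ m' ∈ ah, ((dc m' : ℝ) : ℂ) • ((V m')ᴴ - V m') + ∑ k ∈ w, a k • ladderWord (word k)) +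
        ∑ e ∈ kk, (kktForm (pairSourceWindowHamiltonianTT' dWaveFormFactor Λ' t' U μ' 0) (G e)
            (fun b => fermionEmbed (PolySite.incl hΛ) (Bk e b)) +
          ((sk e : ℝ) : ℂ) • gramForm (G e) (fun b => fermionEmbed (PolySite.incl hΛ) (Bk e b)))) :
    2 * (ω.expect (pairRegion (insert (0 : Site 2) unitSteps) 0)
        (localPairAt (insert (0 : Site 2) unitSteps) dWaveFormFactor 0)).re ≤
      -(c - ∑ k ∈ w, ‖a k‖ + (∑ σ : Fin 2, μf σ) * (ω.density / 2 - ν)) +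
        Δ * ∑ i ∈ sc, |cc i * (ladderCharge (lc i) : ℝ)| * Baux i := by
  have hmain := re_sum_twistedFlipAct_expect_ge_of_chargedCell_certificate hmin hnear hΛ h8 h0 hz _ κp κm u lo μf ν
    hcap hlo hΛm O s B hB0 sc cc Baux lc haux tt γ wv fl mt hsh bb yw ah dc V w a word kk G hG Bk qk sk hqk hsk hcert
  simp_rw [map_neg, Complex.neg_re, (ω.twistedFlipAct _).re_expect_fermionEmbed_localPairAt_add_conjTranspose hP,
    Finset.sum_neg_distrib, ← Finset.mul_sum, ω.sum_re_expect_localPairAt_dWave_twistedFlipAct] at hmain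
  linarith

/-- **Auxiliary two-sided bound from two one-point nodes** (the shape `haux` of the cell reader). The auxiliary
certificates on a charged word `W` are read by `re_sum_twistedFlipAct_expect_ge_of_chargedCell_certificate` itself
(objectives `Xw = Γ W` and `Xw = −Γ W`, empty charged block — they may carry neutral `eom` and `kkt` rows, since they
are read in the SAME ground state): lower nodes `ℓ₊ ≤ (1/32) Σ_g Re (α_g ω)(Γ W)` and `ℓ₋ ≤ (1/32) Σ_g Re (α_g ω)(−Γ W)`
with `−B ≤ ℓ₊`, `−B ≤ ℓ₋` give `|(1/32) Σ_g Re (α_g ω)(Γ W)| ≤ B`. [folklore] -/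
theorem abs_orbitMean_le_of_lower_nodes (ω : InfVolFermionState 2) {Λ' : Finset (Site 2)} (X : FermionOp Λ')
    {ℓp ℓm B : ℝ}
    (hlo : ℓp ≤ (∑ g : TwistFlipIndex, ((ω.twistedFlipAct g).expect Λ' X).re) / 32)
    (hup : ℓm ≤ (∑ g : TwistFlipIndex, ((ω.twistedFlipAct g).expect Λ' (-X)).re) / 32)
    (hBp : -B ≤ ℓp) (hBm : -B ≤ ℓm) :
    |(∑ g : TwistFlipIndex, ((ω.twistedFlipAct g).expect Λ' X).re) / 32| ≤ B := by
  simp_rw [map_neg, Complex.neg_re, Finset.sum_neg_distrib] at hup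
  rw [neg_div] at hup
  exact abs_le.2 ⟨by linarith, by linarith⟩

end CellsB

/-! ### §4  The `μ`-COVER consumer on the ground-state class ⇒ the registry leaf `ObsPairLROCeilingAt` -/

section Cover

/-- **A translation-invariant minimiser of `H^{tt'} − μN` of density `n` has energy density at most `e(n)`** (`U ≥ 0`,
`0 ≤ n < 2`): `e^{tt'}(ω) − μ n = e_GC(μ) ≤ e(n) − μ n`. Hence a certified cap `e(n) ≤ u` discharges the cap row on the
whole ground-state class. [cite: BratteliKishimotoRobinson1978, Thm. 2 (condition 2)] [cite: Ruelle1969, §3.4] -/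
theorem meanEnergy_le_energyDensityTT'_of_isMeanEnergyMinimiser_hubbardTTPrimeMu {tp U μ n : ℝ} (hU : 0 ≤ U)
    (hn0 : 0 ≤ n) (hn2 : n < 2) {ω : InfVolFermionState 2}
    (hmin : ω.IsMeanEnergyMinimiser (hubbardTTPrimeMuInteraction 1 tp U μ) 1) (hρ : ω.density = n) :
    ω.meanEnergy (hubbardTTPrimeFermionInteraction 1 tp U) 1 ≤ energyDensityTT' 1 tp U n := by
  have h1 := hmin.meanEnergy_eq
  have h2 := FermionInteraction.tiGroundEnergyDensity_hubbardTTPrimeMu_le_energyDensityTT'_sub 1 tp hU μ hn0 hn2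
  rw [InfVolFermionState.meanEnergy_hubbardTTPrimeMu, hρ] at h1
  linarith

/-- **THE `μ`-COVER CONSUMER ON THE GROUND-STATE CLASS.** At an anchor `(U, n, t')` (`t = 1`, `U ≥ 0`, `0 < n < 2`):
a certified cap `e(1,t',U,n) ≤ u`, a certified bracket `[μlo, μhi] ⊇ [μ₋(n), μ₊(n)]` of the subdifferential, a finite
family of cells `j` (grid points `μg j`, half-widths `Δg j`) COVERING the bracket, and for each cell a ONE-POINT CELL
SENTENCE «every translation-invariant minimiser `ω` of `H^{tt'} − μ_c N` (`= hubbardTTPrimeSourcedInteraction 1 t' U μ_c d 0`)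
with `|μg j − μ_c| ≤ Δg j`, density `n` and `e^{tt'}(ω) ≤ u` has `Re ω(P₀^d) ≤ M j`» (the conclusion of
`two_mul_re_expect_localPairAt_le_of_chargedCell_certificate` with its auxiliary nodes read in the same class) give the
registry leaf `ObsPairLROCeilingAt t' U n c'` for every rational `c' ≥ 0` dominating the `M j²` — through the
ground-state-complete one-point reading `ObsPairLROCeilingAt_of_groundState_onePoint_bound` (Koma–Tasaki tower
witnesses have ground-state torus limits; sharp constant). Identity-form twin of
`ObsPairLROCeilingAt_of_onePoint_charged_twistedFlip_orbitState_gridCells_bound_sq_aux`.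
[cite: KomaTasaki1994, Theorem 5] [cite: BratteliKishimotoRobinson1978, Thm. 2 (p. 47)] -/
theorem ObsPairLROCeilingAt_of_groundStateClass_cells {tp U n : ℝ} (hU : 0 ≤ U) (hn0 : 0 < n) (hn2 : n < 2)
    {u : ℝ} (hu : energyDensityTT' 1 tp U n ≤ u)
    {μlo μhi : ℝ} (hμlo : μlo ≤ chemPotMinusTT' 1 tp U n) (hμhi : chemPotPlusTT' 1 tp U n ≤ μhi)
    {J : Type*} (cells : Finset J) (μg Δg M : J → ℝ)
    (hcover : ∀ μ ∈ Set.Icc μlo μhi, ∃ j ∈ cells, |μg j - μ| ≤ Δg j)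
    (hcell : ∀ j ∈ cells, ∀ μc : ℝ, |μg j - μc| ≤ Δg j → ∀ ω : InfVolFermionState 2,
      ω.IsMeanEnergyMinimiser (hubbardTTPrimeSourcedInteraction 1 tp U μc dWaveFormFactor 0) 1 →
      ω.density = n → ω.meanEnergy (hubbardTTPrimeFermionInteraction 1 tp U) 1 ≤ u →
        (ω.expect (pairRegion (insert (0 : Site 2) unitSteps) 0)
          (localPairAt (insert (0 : Site 2) unitSteps) dWaveFormFactor 0)).re ≤ M j)
    {c' : ℚ} (hc'0 : 0 ≤ (c' : ℝ)) (hc' : ∀ j ∈ cells, M j ^ 2 ≤ (c' : ℝ)) :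
    ObsPairLROCeilingAt tp U n c' := by
  refine ObsPairLROCeilingAt_of_groundState_onePoint_bound hU hn0 hn2 (M := Real.sqrt (c' : ℝ)) ?_
    (by rw [Real.sq_sqrt hc'0])
  intro μc hμc ω _hTI hρ hmin _hgs
  obtain ⟨j, hj, hjμ⟩ := hcover μc ⟨hμlo.trans hμc.1, hμc.2.trans hμhi⟩
  have he : ω.meanEnergy (hubbardTTPrimeFermionInteraction 1 tp U) 1 ≤ u :=
    (meanEnergy_le_energyDensityTT'_of_isMeanEnergyMinimiser_hubbardTTPrimeMu hU hn0.le hn2 hmin hρ).trans hu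
  have hmin' : ω.IsMeanEnergyMinimiser (hubbardTTPrimeSourcedInteraction 1 tp U μc dWaveFormFactor 0) 1 := by
    rw [hubbardTTPrimeSourcedInteraction_zero_source]; exact hmin
  have hle := hcell j hj μc hjμ ω hmin' hρ he
  calc (ω.expect (pairRegion (insert (0 : Site 2) unitSteps) 0)
          (localPairAt (insert (0 : Site 2) unitSteps) dWaveFormFactor 0)).re
        ≤ M j := hle
    _ ≤ |M j| := le_abs_self _
    _ = Real.sqrt (M j ^ 2) := (Real.sqrt_sq_eq_abs (M j)).symm
    _ ≤ Real.sqrt (c' : ℝ) := Real.sqrt_le_sqrt (hc' j hj)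

end Cover

/-! ### §5  PRODUCER FORM: a monotone `μ`-grid of cells (appended) -/

section Grid

/-- **PRODUCER FORM of the cover consumer: a monotone grid of closed cells.** At an anchor `(U, n, t')` (`t = 1`,
`U ≥ 0`, `0 < n < 2`): a certified cap `e(n) ≤ u`, a monotone grid `m : Fin (J+2) → ℝ` with `m 0 ≤ μ₋(n)` and
`μ₊(n) ≤ m (Fin.last (J+1))` (the certified bracket rows), per cell `j : Fin (J+1)` a grid point and half-width with
`μg j − Δg j ≤ m j.castSucc`, `m j.succ ≤ μg j + Δg j` (finitely many rational inequalities), and per cell the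
ONE-POINT CELL SENTENCE on the ground-state class («every translation-invariant minimiser `ω` of `H^{tt'} − μ_c N`,
`|μg j − μ_c| ≤ Δg j`, of density `n` with `e^{tt'}(ω) ≤ u` has `Re ω(P₀^d) ≤ M j`» — the shape an identity-form cell
NODE states and `two_mul_re_expect_localPairAt_le_of_chargedCell_certificate` justifies) ⇒ `ObsPairLROCeilingAt t' U n c'`
at every rational `c' ≥ 0` with `M j² ≤ c'` for all `j`. At `(8, 7/8, 0)` the registry leaf `M3ObsPairLROCeilingAt_tp0 c'`
is the same statement (`obsPairLROCeilingAt_m3_tp0_iff`). Identity-form twin of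
`ObsPairLROCeilingAt_of_onePoint_chargedStationary_gridCells_bound_sq`. [cite: KomaTasaki1994, Theorem 5]
[cite: BratteliKishimotoRobinson1978, Thm. 2 (p. 47)] -/
theorem ObsPairLROCeilingAt_of_groundStateClass_gridCells {tp U n : ℝ} (hU : 0 ≤ U) (hn0 : 0 < n) (hn2 : n < 2)
    {u : ℝ} (hu : energyDensityTT' 1 tp U n ≤ u) {J : ℕ} (m : Fin (J + 2) → ℝ) (hm : Monotone m)
    (hlo : m 0 ≤ chemPotMinusTT' 1 tp U n) (hhi : chemPotPlusTT' 1 tp U n ≤ m (Fin.last (J + 1)))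
    (μg Δg M : Fin (J + 1) → ℝ) (hleft : ∀ j, μg j - Δg j ≤ m j.castSucc) (hright : ∀ j, m j.succ ≤ μg j + Δg j)
    (hcell : ∀ j, ∀ μc : ℝ, |μg j - μc| ≤ Δg j → ∀ ω : InfVolFermionState 2,
      ω.IsMeanEnergyMinimiser (hubbardTTPrimeSourcedInteraction 1 tp U μc dWaveFormFactor 0) 1 →
      ω.density = n → ω.meanEnergy (hubbardTTPrimeFermionInteraction 1 tp U) 1 ≤ u →
        (ω.expect (pairRegion (insert (0 : Site 2) unitSteps) 0)
          (localPairAt (insert (0 : Site 2) unitSteps) dWaveFormFactor 0)).re ≤ M j)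
    {c' : ℚ} (hc'0 : 0 ≤ (c' : ℝ)) (hc' : ∀ j, M j ^ 2 ≤ (c' : ℝ)) :
    ObsPairLROCeilingAt tp U n c' := by
  refine ObsPairLROCeilingAt_of_groundStateClass_cells hU hn0 hn2 hu hlo hhi (Finset.univ : Finset (Fin (J + 1)))
    μg Δg M ?_ (fun j _ => hcell j) hc'0 (fun j _ => hc' j)
  intro μ hμ
  obtain ⟨j, hj⟩ := exists_mem_Icc_castSucc_succ_of_monotone hm hμ
  refine ⟨j, Finset.mem_univ _, abs_le.2 ⟨?_, ?_⟩⟩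
  · linarith [hj.2, hright j]
  · linarith [hj.1, hleft j]

end Grid

/-! ### §6  ONE CELL at a CERTIFIED point of the subdifferential (appended): no cover; half filling exact at `μ' = U/2` -/

section OneCell

/-- **ONE CELL SUFFICES at a certified point of the subdifferential.** If some `μ₀` with `μ₋(n) ≤ μ₀ ≤ μ₊(n)` is
CERTIFIED (e.g. `μ₀ = U/2` at half filling and `t' = 0`, `half_mem_Icc_chemPot_one`), then ONE cell `(μg, Δg)` with
`|μg − μ₀| ≤ Δg` and its one-point cell sentence on the ground-state class (+ the cap `e(n) ≤ u`) give
`ObsPairLROCeilingAt t' U n c'` for every rational `c' ≥ M²` — through hubbard-obs-gs-2's «all `μ`» reading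
`ObsPairLROCeilingAt_of_groundState_onePoint_bound_at` (the tower witnesses' torus limits are minimisers of
`H^{tt'} − μN` at EVERY `μ` of the subdifferential, in particular at `μ₀`). [cite: KomaTasaki1994, Theorem 5]
[cite: BratteliKishimotoRobinson1978, Thm. 2 (p. 47)] -/
theorem ObsPairLROCeilingAt_of_groundStateClass_cell_at {tp U n : ℝ} (hU : 0 ≤ U) (hn0 : 0 < n) (hn2 : n < 2)
    {u : ℝ} (hu : energyDensityTT' 1 tp U n ≤ u)
    {μ₀ : ℝ} (hμ₀ : μ₀ ∈ Set.Icc (chemPotMinusTT' 1 tp U n) (chemPotPlusTT' 1 tp U n))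
    (μg Δg M : ℝ) (hnear : |μg - μ₀| ≤ Δg)
    (hcell : ∀ μc : ℝ, |μg - μc| ≤ Δg → ∀ ω : InfVolFermionState 2,
      ω.IsMeanEnergyMinimiser (hubbardTTPrimeSourcedInteraction 1 tp U μc dWaveFormFactor 0) 1 →
      ω.density = n → ω.meanEnergy (hubbardTTPrimeFermionInteraction 1 tp U) 1 ≤ u →
        (ω.expect (pairRegion (insert (0 : Site 2) unitSteps) 0)
          (localPairAt (insert (0 : Site 2) unitSteps) dWaveFormFactor 0)).re ≤ M)
    {c' : ℚ} (hc' : M ^ 2 ≤ (c' : ℝ)) :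
    ObsPairLROCeilingAt tp U n c' := by
  refine ObsPairLROCeilingAt_of_groundState_onePoint_bound_at hU hn0 hn2 hμ₀ ?_ hc'
  intro ω _hTI hρ hmin _hgs
  have he : ω.meanEnergy (hubbardTTPrimeFermionInteraction 1 tp U) 1 ≤ u :=
    (meanEnergy_le_energyDensityTT'_of_isMeanEnergyMinimiser_hubbardTTPrimeMu hU hn0.le hn2 hmin hρ).trans hu
  have hmin' : ω.IsMeanEnergyMinimiser (hubbardTTPrimeSourcedInteraction 1 tp U μ₀ dWaveFormFactor 0) 1 := by
    rw [hubbardTTPrimeSourcedInteraction_zero_source]; exact hmin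
  exact hcell μ₀ hnear ω hmin' hρ he

/-- **HALF FILLING, `t' = 0`: one cell around `μ' = U/2`, and with `Δ = 0` the charged rows are EXACT.** At the
control anchors `(U, 1, 0)` (`U ≥ 0`) particle–hole symmetry certifies `U/2 ∈ [μ₋(1), μ₊(1)]`
(`half_mem_Icc_chemPot_one`), so ONE identity-form cell `(μg, Δg)` with `|μg − U/2| ≤ Δg` — in particular the
degenerate cell `μg = U/2`, `Δg = 0`, i.e. charged stationarity and charged `kkt` blocks imposed EXACTLY at `μ = U/2`
with no slack and no auxiliary certificate — and the cap `e(1,0,U,1) ≤ u` give `ObsPairLROCeilingAt 0 U 1 c'`,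
`c' ≥ M²`. [cite: KomaTasaki1994, Theorem 5] [cite: LiebWuPhysicaA2003, §7] -/
theorem ObsPairLROCeilingAt_halfFilling_of_groundStateClass_cell {U : ℝ} (hU : 0 ≤ U)
    {u : ℝ} (hu : energyDensityTT' 1 0 U 1 ≤ u) (μg Δg M : ℝ) (hnear : |μg - U / 2| ≤ Δg)
    (hcell : ∀ μc : ℝ, |μg - μc| ≤ Δg → ∀ ω : InfVolFermionState 2,
      ω.IsMeanEnergyMinimiser (hubbardTTPrimeSourcedInteraction 1 0 U μc dWaveFormFactor 0) 1 →
      ω.density = 1 → ω.meanEnergy (hubbardTTPrimeFermionInteraction 1 0 U) 1 ≤ u →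
        (ω.expect (pairRegion (insert (0 : Site 2) unitSteps) 0)
          (localPairAt (insert (0 : Site 2) unitSteps) dWaveFormFactor 0)).re ≤ M)
    {c' : ℚ} (hc' : M ^ 2 ≤ (c' : ℝ)) :
    ObsPairLROCeilingAt 0 U 1 c' :=
  ObsPairLROCeilingAt_of_groundStateClass_cell_at hU one_pos one_lt_two hu (half_mem_Icc_chemPot_one 1 hU) μg Δg M
    hnear hcell hc'

end OneCell

end Summit.Ventures.CertifiedManyBodySolver.Observables


end
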